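import Mathlib
import HarnessLib
import Summits.NavierStokesRegularity.NavierStokesRegularity.Theses.PoloidalWindowDoor
import Summits.NavierStokesRegularity.NavierStokesRegularity.Theorems.PoloidalWindowDoorPoloidalWindowRigiditySharper
import Summits.NavierStokesRegularity.NavierStokesRegularity.Theorems.PoloidalWindowDoorPoloidalWindowRigidityFlat
import Summits.NavierStokesRegularity.NavierStokesRegularity.Theorems.PoloidalWindowDoorLrcModEntireIff
import Summits.NavierStokesRegularity.NavierStokesRegularity.Theorems.PoloidalWindowDoorLrcModEntireUntwistedGerm
import Summits.NavierStokesRegularity.NavierStokesRegularity.Theorems.PoloidalWindowDoorLrcModEntireTwistingTHLocalHypGerm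
import Summits.NavierStokesRegularity.NavierStokesRegularity.Theorems.PoloidalWindowDoorLrcModEntireTwistingTHLocalNonUmbilic
import Summits.NavierStokesRegularity.NavierStokesRegularity.Theorems.PoloidalWindowDoorLrcModEntireTwistingTHLocalGalilean
import Summits.NavierStokesRegularity.NavierStokesRegularity.Theorems.PoloidalWindowDoorLrcModEntireTwistingTHLocalNormalFormRS
import Summits.NavierStokesRegularity.NavierStokesRegularity.Theorems.PoloidalWindowDoorPoloidalWindowRigidityTimeShearClosed
import Summits.NavierStokesRegularity.NavierStokesRegularity.Theorems.PoloidalWindowDoorPoloidalWindowRigiditySymmetryGerms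
import Summits.NavierStokesRegularity.NavierStokesRegularity.Theorems.PoloidalWindowDoorPoloidalWindowRigidityVerticalShearGerm
import Summits.NavierStokesRegularity.NavierStokesRegularity.Theorems.LocalSineTubeDoorProfileAlignedWindowRigidityAncient

/-!
# SKELETON `far_thread` v4 (= v3 + `push_neg` lint fix; v3 = v2 + S5 `threadSignedPin` PROVED sorry-free; v2 = v1 + critic prices P1/P2 of idea-crit-7 g2 07:25:50Z: signed-pin statement (S5) consumed by S3; Morse/flat split = line `thread_axis`) — crux `PoloidalWindowRigidity` (K2, stmt-NavierStokesRegularity-19708; closes ALSO the promoted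
# stub `LrcModEntire`, stmt-NavierStokesRegularity-20428), route `PoloidalWindowDoor`, THICK column — ideator seat ns-idea-8 gen 2
# (lens «barrier»; files-only per KEY-NS #68/#69: NOT the skeleton of record; the K2 leads decide adoption).

LEVER (five words): **compactness recentring forces a thread.**  A «thread» of a class profile is a point of a horizontal plane where
the vertical velocity `w = v₂` is critical and non-zero (`∂₀v₂ = ∂₁v₂ = 0`, `v₂ ≠ 0`).  The move: the sub-class «Type-I ancient mild +
poloidal along e₃» is invariant under space translations and parabolic rescalings and COMPACT under KNSS limits (fields AND gradients
converge: tree `exists_tendsto_of_isTypeIAncientMild_seq`, `poloidal_of_tendsto`, `poloidal_translate`, `poloidal_nsRescale`), so a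
profile with `v₂ ≢ 0` can be recentred at near-maximisers of the scale-invariant size `√(−t)|v₂(t,x)|` and passed to the limit: the
limit profile ATTAINS that supremum at the hot spot `(−1, 0)` (`stub_extremalThread`).  A hot spot is a thread with extra free pins
(`∇v₂(−1,0) = 0`, `v₂·D²v₂(−1,0) ≤ 0`, `∂ₜv₂ = v₂/2` there) — proved below from the normalisation (`threadPin_of_hotSpot`).  The limit may
leave the thick stratum, so EVERY column must be consumed in LIOUVILLE currency (`v ≡ 0`), which the tree provides for all columns but
two: untwisted (`stub_untwistedGerm` p560652 + `eq_zero_of_germ`), (TV) (`timeShear_normalForm` + `eq_zero_of_timeShear_liminf` /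
`eq_zero_of_timeShear_unbounded`), degenerate open germs (`eq_zero_of_curl_eq_zero_on_open`, `eq_zero_of_horizontalGradient_eq_zero_on_open`,
`eq_zero_of_verticalShear_eq_zero_on_open`); the (TH)∩twisting column is the SHARED registered local stub `stub_localTHEmptyHypNUGRS`
(VERBATIM `twist_split` v4.3, item 20428) through the tree chain `…TwistingTHLocalHypGerm.stub_twistingTH_of_localEmptyHyp`; and the
THICK∩twisting column is THIS LINE's deciding stub, now pinned at a thread: `stub_threadedThickEmpty`.  The elementary point-dichotomy
`stub_threadDichotomy` (continuity of the Jacobian entries only) sorts the hot spot into exactly these five cases.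

COMPOSITION (kernel-checked, no sorry outside `stub_*`): `poloidalLiouville_of_farThread` (class + poloidal ⇒ `v ≡ 0`) ⇒
`PoloidalWindowRigidity_of_farThread : …Theses.PoloidalWindowDoor.PoloidalWindowRigidity` (via the landed reduction
`…Sharper.poloidalWindowRigidity_of_sliceSharpNonflatLiouville`) and `LrcModEntire_of_farThread : …Theses.PoloidalWindowDoor.LrcModEntire`.

WHY EASIER AT A THREAD (card §why-easier): in the THICK normal form (`w = v₂`, `u_h = ∇_hφ`, `φ_z = G(t,z,w)`, `Λ = G_w`, THICK ⇔ `G_ww ≠ 0`,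
leaves = level curves of `w` on horizontal planes = vortex lines) the leaf space PINCHES at a thread: `G(t,z,·)` is single-valued
real-analytic AT the interior critical value `w* = w(thread)`, and `w − w*` starts at order two, so every structure function
(`G`, the pressure head, the Bernoulli datum) enters the Taylor hierarchy at HALF RATE — one new coefficient per two orders of the jet of `w` —
while the equations (frozen law, incompressibility, vertical momentum with (M)) keep full rate: a strictly more over-determined hierarchy
than at a generic point (where cert-1's jets are passive to order 13), linear algebra per order, no ansatz.  Second engine at a
max-thread: the closed-leaf disc moments `𝒜(c) = |{w > c}|`, `T = ∮ ds/|∇w|`, `J = ∮ w_z²/|∇w| ds` with the exact twist slack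
`J·T ≥ 𝒜_z²` (equality iff the leaf is untwisted) and the disc-integrated vertical momentum, which closes on (`𝒜`, `J`, `G`, head).

WHAT THIS IS NOT: not a proof of Navier–Stokes regularity, of K2, or of the THICK column — a typed line with ONE research stub
(`stub_threadedThickEmpty`), two provable normal-form stubs and one shared registered stub; (M) and the Type-I class are kept in every
class-level stub (honours `Negative.poloidalWindowRigidity_false_without_mild`, K-47 `twisting_false_without_mild`, K-50 `thickProfile`).
bears_on LADDER-NS N0 (rung N0-LocalTubeDoorPoloidal), items 19708 / 20428.
-/

noncomputable section

set_option linter.dupNamespace false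
set_option linter.unusedVariables false

namespace Summit.NavierStokesRegularity.NavierStokesRegularity.Cruxes.PoloidalWindowRigidity.FarThread

open MeasureTheory Set Function Filter Topology Metric
open scoped RealInnerProductSpace InnerProductSpace Laplacian
open Literature.Analysis Literature.Analysis.FluidPDE
open Summit.NavierStokesRegularity.NavierStokesRegularity.Theses.PoloidalWindowDoor
open Summit.NavierStokesRegularity.NavierStokesRegularity.Theorems.LocalSineTubeDoorProfileAlignedWindowRigidityAncient
open Summit.NavierStokesRegularity.NavierStokesRegularity.Theorems.PoloidalWindowDoorPoloidalWindowRigiditySharper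
open Summit.NavierStokesRegularity.NavierStokesRegularity.Theorems.PoloidalWindowDoorPoloidalWindowRigidityFlat
open Summit.NavierStokesRegularity.NavierStokesRegularity.Theorems.PoloidalWindowDoorLrcModEntireIff
open Summit.NavierStokesRegularity.NavierStokesRegularity.Theorems.PoloidalWindowDoorLrcModEntireUntwistedGerm
open Summit.NavierStokesRegularity.NavierStokesRegularity.Theorems.PoloidalWindowDoorLrcModEntireTwistingTHLocalHypGerm
open Summit.NavierStokesRegularity.NavierStokesRegularity.Theorems.PoloidalWindowDoorLrcModEntireTwistingTHLocalNonUmbilic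
open Summit.NavierStokesRegularity.NavierStokesRegularity.Theorems.PoloidalWindowDoorLrcModEntireTwistingTHLocalGalilean
open Summit.NavierStokesRegularity.NavierStokesRegularity.Theorems.PoloidalWindowDoorLrcModEntireTwistingTHLocalNormalFormRS
open Summit.NavierStokesRegularity.NavierStokesRegularity.Theorems.PoloidalWindowDoorPoloidalWindowRigidityTimeShearPressure
open Summit.NavierStokesRegularity.NavierStokesRegularity.Theorems.PoloidalWindowDoorPoloidalWindowRigidityTimeShearLiminf
open Summit.NavierStokesRegularity.NavierStokesRegularity.Theorems.PoloidalWindowDoorPoloidalWindowRigidityHorizontalFlatPast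
open Summit.NavierStokesRegularity.NavierStokesRegularity.Theorems.PoloidalWindowDoorPoloidalWindowRigiditySymmetryGerms
open Summit.NavierStokesRegularity.NavierStokesRegularity.Theorems.PoloidalWindowDoorPoloidalWindowRigidityVerticalShearGerm
open Summit.NavierStokesRegularity.NavierStokesRegularity.Theorems.LocalSineTubeDoorProfileAlignedWindowRigidityAncient

/-! ## The stubs -/

/-- **SHARED STUB ((TH) column) — VERBATIM `stub_localTHEmptyHypNUGRS` of the skeleton of record `Cruxes/LrcModEntire/Lines/twist_split.lean`
v4.3 (ns-poloidal-K2-p3 g9; item stmt-NavierStokesRegularity-20428).**  The local hyperbolic (TH)∩twisting PDE system is empty at a non-umbilic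
rest point in the rotation/scaling gauge.  One landing closes it here and there.  (This line needs the (TH) column in LIOUVILLE currency — the
recentred profile is not known to be singular — which is exactly what the local statement gives through
`…TwistingTHLocalHypGerm.stub_twistingTH_of_localEmptyHyp` + `…LrcModEntireIff.eq_zero_of_germ`.) -/
theorem stub_localTHEmptyHypNUGRS :
    ∀ (u : ℝ → EuclideanSpace ℝ (Fin 3) → EuclideanSpace ℝ (Fin 3)) (μ A : ℝ → ℝ → ℝ)
      (U : Set (ℝ × EuclideanSpace ℝ (Fin 3))) (p₀ : ℝ × EuclideanSpace ℝ (Fin 3)),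
      IsOpen U → p₀ ∈ U →
      AnalyticOnNhd ℝ (Function.uncurry u) U →
      (∀ p ∈ U, AnalyticAt ℝ (Function.uncurry μ) (p.1, p.2 2)) →
      (∀ p ∈ U, AnalyticAt ℝ (Function.uncurry A) (p.1, p.2 2)) →
      (∀ p ∈ U, fderiv ℝ (u p.1) p.2 (EuclideanSpace.single 0 1) 1 = fderiv ℝ (u p.1) p.2 (EuclideanSpace.single 1 1) 0) →
      (∀ p ∈ U, fderiv ℝ (u p.1) p.2 (EuclideanSpace.single 0 1) 0 + fderiv ℝ (u p.1) p.2 (EuclideanSpace.single 1 1) 1 +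
        fderiv ℝ (u p.1) p.2 (EuclideanSpace.single 2 1) 2 = 0) →
      (∀ p ∈ U, ∀ b : Fin 3, b ≠ 2 →
        fderiv ℝ (u p.1) p.2 (EuclideanSpace.single 2 1) b =
          μ p.1 (p.2 2) * fderiv ℝ (u p.1) p.2 (EuclideanSpace.single b 1) 2) →
      (∀ p ∈ U,
        (1 - μ p.1 (p.2 2)) *
            (deriv (fun s => u s p.2 2) p.1 + fderiv ℝ (fun y => u p.1 y 2) p.2 (u p.1 p.2)
              - Δ (fun y => u p.1 y 2) p.2) =
          A p.1 (p.2 2) + (deriv (fun s => μ s (p.2 2)) p.1 - deriv (deriv (μ p.1)) (p.2 2)) * u p.1 p.2 2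
            + deriv (μ p.1) (p.2 2) / 2 * u p.1 p.2 2 ^ 2
            - 2 * deriv (μ p.1) (p.2 2) * fderiv ℝ (u p.1) p.2 (EuclideanSpace.single 2 1) 2) →
      fderiv ℝ (fun y => fderiv ℝ (u p₀.1) y (EuclideanSpace.single 2 1) 2) p₀.2 (EuclideanSpace.single 0 1) *
            fderiv ℝ (u p₀.1) p₀.2 (EuclideanSpace.single 1 1) 2 -
          fderiv ℝ (fun y => fderiv ℝ (u p₀.1) y (EuclideanSpace.single 2 1) 2) p₀.2 (EuclideanSpace.single 1 1) *
            fderiv ℝ (u p₀.1) p₀.2 (EuclideanSpace.single 0 1) 2 ≠ 0 →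
      μ p₀.1 (p₀.2 2) ≠ 0 → μ p₀.1 (p₀.2 2) ≠ 1 → deriv (μ p₀.1) (p₀.2 2) ≠ 0 →
      μ p₀.1 (p₀.2 2) < 0 →
      (fderiv ℝ (u p₀.1) p₀.2 (EuclideanSpace.single 0 1) 0 ≠ fderiv ℝ (u p₀.1) p₀.2 (EuclideanSpace.single 1 1) 1 ∨
        fderiv ℝ (u p₀.1) p₀.2 (EuclideanSpace.single 1 1) 0 ≠ 0) →
      u p₀.1 p₀.2 = 0 → 
      fderiv ℝ (u p₀.1) p₀.2 (EuclideanSpace.single 0 1) 2 = 0 →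
      fderiv ℝ (u p₀.1) p₀.2 (EuclideanSpace.single 1 1) 2 = 1 → False := by
  sorry

/-- **STUB S1 (provable, M): EXTREMAL RECENTRING — a poloidal class profile with `v₂ ≢ 0` has a companion in the SAME class (same
constant `C`), poloidal, whose scale-invariant vertical size `√(−t)|v₂(t,x)|` ATTAINS its supremum over the slab at the hot spot `(−1,0)`.**
Proof route (all ingredients in the tree): `N := sup √(−t)|v₂| ∈ (0, C]`; near-maximisers `(t_k, x_k)`; `v_k := λ_k v(λ_k² ·, x_k + λ_k ·)`,
`λ_k = √(−t_k)` (class and poloidality are invariant: `…PoloidalExtremal.poloidal_translate/poloidal_nsRescale`, `isTypeIAncientMild_of_class`);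
KNSS compactness `…SqueezeCycleExtremalElementExistsExtraction.exists_tendsto_of_isTypeIAncientMild_seq` (fields and gradients converge, so the
limit is poloidal: `poloidal_of_tendsto`); pointwise limits give `√(−t)|v'₂| ≤ N` everywhere and `|v'₂(−1,0)| = N`.  No minimality, no
ε-regularity.  A thread for free: `threadPin_of_hotSpot` below. -/
theorem stub_extremalThread :
    ∀ (C : ℝ) (v : ℝ → EuclideanSpace ℝ (Fin 3) → EuclideanSpace ℝ (Fin 3)),
      Literature.Analysis.FluidPDE.HasTypeITimeDecay C v →
      ContinuousOn (Function.uncurry v) (Set.Iio (0 : ℝ) ×ˢ Set.univ) →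
      (∀ s t : ℝ, s < t → t < 0 → ∀ x, v t x =
        Literature.Analysis.UnboundedOperators.heatExtension (v s) (t - s) x -
          Literature.Analysis.FluidPDE.oseenDuhamel 1 s v v t x) →
      (∀ t < 0, Literature.Analysis.FluidPDE.VectorCalculus.IsDivFree (v t)) →
      (∀ s < 0, ∀ y, ⟪Literature.Analysis.FluidPDE.curl (v s) y, EuclideanSpace.single 2 1⟫_ℝ = 0) →
      (∃ t₀ : ℝ, t₀ < 0 ∧ ∃ y₀ : EuclideanSpace ℝ (Fin 3), v t₀ y₀ 2 ≠ 0) →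
      ∃ v' : ℝ → EuclideanSpace ℝ (Fin 3) → EuclideanSpace ℝ (Fin 3),
        Literature.Analysis.FluidPDE.HasTypeITimeDecay C v' ∧
        ContinuousOn (Function.uncurry v') (Set.Iio (0 : ℝ) ×ˢ Set.univ) ∧
        (∀ s t : ℝ, s < t → t < 0 → ∀ x, v' t x =
          Literature.Analysis.UnboundedOperators.heatExtension (v' s) (t - s) x -
            Literature.Analysis.FluidPDE.oseenDuhamel 1 s v' v' t x) ∧
        (∀ t < 0, Literature.Analysis.FluidPDE.VectorCalculus.IsDivFree (v' t)) ∧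
        (∀ s < 0, ∀ y, ⟪Literature.Analysis.FluidPDE.curl (v' s) y, EuclideanSpace.single 2 1⟫_ℝ = 0) ∧
        v' (-1) 0 2 ≠ 0 ∧ (∀ t < 0, ∀ x, Real.sqrt (-t) * |v' t x 2| ≤ |v' (-1) 0 2|) := by
  sorry

/-- **STUB S2 (provable, M): THE POINT DICHOTOMY AT `z₀`** — continuity of the Jacobian entries and of the twist bracket on the slab
(`…K2OfLrcSlope.continuousOn_fderiv_entry`, `…ThmARelocation.continuousOn_twist`) only.  For a poloidal class profile and a point `z₀` of the
backward slab, ONE of: (i) an open `W ⊆ slab` of non-degenerate TWISTING points which is THICK (the slope `∂₂v_b/∂_bv₂` is a function of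
`(t, x₂)` on NO open subset) and ACCUMULATES at `z₀`; (ii) a non-degenerate UNTWISTED window; (iii) a non-degenerate, pinned, twisting (TH)
window; (iv) a window with TIME-ONLY slope; (v) an open DEGENERATE germ on one slice (irrotational / horizontally flat / vertically rigid).
Proof sketch: `O := slab ∩ {ND ∧ T ≠ 0}` is open; if `z₀ ∈ closure O` then (i) with `W = O` unless thickness fails on a sub-window (⇒ (iii),
or (iv) if its pin fails); else a ball about `z₀` misses `O`: a non-degenerate point in it gives (ii), otherwise the pointwise degenerate
disjunction on the ball's `z₀.1`-slice splits into (v) by `…DegenerateSlice.forall_or_exists_open_of_pointwise_or`. -/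
theorem stub_threadDichotomy :
    ∀ (C : ℝ) (v : ℝ → EuclideanSpace ℝ (Fin 3) → EuclideanSpace ℝ (Fin 3)),
      Literature.Analysis.FluidPDE.HasTypeITimeDecay C v →
      ContinuousOn (Function.uncurry v) (Set.Iio (0 : ℝ) ×ˢ Set.univ) →
      (∀ s t : ℝ, s < t → t < 0 → ∀ x, v t x =
        Literature.Analysis.UnboundedOperators.heatExtension (v s) (t - s) x -
          Literature.Analysis.FluidPDE.oseenDuhamel 1 s v v t x) →
      (∀ t < 0, Literature.Analysis.FluidPDE.VectorCalculus.IsDivFree (v t)) →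
      (∀ s < 0, ∀ y, ⟪Literature.Analysis.FluidPDE.curl (v s) y, EuclideanSpace.single 2 1⟫_ℝ = 0) →
      ∀ z₀ : ℝ × EuclideanSpace ℝ (Fin 3), z₀.1 < 0 →
        (∃ W : Set (ℝ × EuclideanSpace ℝ (Fin 3)), IsOpen W ∧ W ⊆ Set.Iio (0 : ℝ) ×ˢ Set.univ ∧
          (∀ z ∈ W, (Literature.Analysis.FluidPDE.curl (v z.1) z.2 ≠ 0 ∧
            (fderiv ℝ (v z.1) z.2 (EuclideanSpace.single 0 1) 2 ≠ 0 ∨ fderiv ℝ (v z.1) z.2 (EuclideanSpace.single 1 1) 2 ≠ 0) ∧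
            (fderiv ℝ (v z.1) z.2 (EuclideanSpace.single 2 1) 0 ≠ 0 ∨ fderiv ℝ (v z.1) z.2 (EuclideanSpace.single 2 1) 1 ≠ 0)) ∧
            (fderiv ℝ (fun x => fderiv ℝ (v z.1) x (EuclideanSpace.single 2 1) 2) z.2 (EuclideanSpace.single 0 1) *
                fderiv ℝ (v z.1) z.2 (EuclideanSpace.single 1 1) 2 -
              fderiv ℝ (fun x => fderiv ℝ (v z.1) x (EuclideanSpace.single 2 1) 2) z.2 (EuclideanSpace.single 1 1) *
                fderiv ℝ (v z.1) z.2 (EuclideanSpace.single 0 1) 2 ≠ 0)) ∧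
          (∀ m : ℝ → ℝ → ℝ, ∀ W₁ : Set (ℝ × EuclideanSpace ℝ (Fin 3)), W₁ ⊆ W → IsOpen W₁ → W₁.Nonempty →
            ∃ z ∈ W₁, ∃ b : Fin 3, b ≠ 2 ∧
              fderiv ℝ (v z.1) z.2 (EuclideanSpace.single 2 1) b ≠
                m z.1 (z.2 2) * fderiv ℝ (v z.1) z.2 (EuclideanSpace.single b 1) 2) ∧
          (∀ r : ℝ, 0 < r → (Metric.ball z₀ r ∩ W).Nonempty)) ∨
        (∃ W : Set (ℝ × EuclideanSpace ℝ (Fin 3)), IsOpen W ∧ W.Nonempty ∧ W ⊆ Set.Iio (0 : ℝ) ×ˢ Set.univ ∧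
          (∀ z ∈ W, (Literature.Analysis.FluidPDE.curl (v z.1) z.2 ≠ 0 ∧
            (fderiv ℝ (v z.1) z.2 (EuclideanSpace.single 0 1) 2 ≠ 0 ∨ fderiv ℝ (v z.1) z.2 (EuclideanSpace.single 1 1) 2 ≠ 0) ∧
            (fderiv ℝ (v z.1) z.2 (EuclideanSpace.single 2 1) 0 ≠ 0 ∨ fderiv ℝ (v z.1) z.2 (EuclideanSpace.single 2 1) 1 ≠ 0))) ∧
          (∀ z ∈ W, (fderiv ℝ (fun x => fderiv ℝ (v z.1) x (EuclideanSpace.single 2 1) 2) z.2 (EuclideanSpace.single 0 1) *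
                fderiv ℝ (v z.1) z.2 (EuclideanSpace.single 1 1) 2 -
              fderiv ℝ (fun x => fderiv ℝ (v z.1) x (EuclideanSpace.single 2 1) 2) z.2 (EuclideanSpace.single 1 1) *
                fderiv ℝ (v z.1) z.2 (EuclideanSpace.single 0 1) 2 = 0))) ∨
        (∃ W : Set (ℝ × EuclideanSpace ℝ (Fin 3)), IsOpen W ∧ W.Nonempty ∧ W ⊆ Set.Iio (0 : ℝ) ×ˢ Set.univ ∧
          (∀ z ∈ W, (Literature.Analysis.FluidPDE.curl (v z.1) z.2 ≠ 0 ∧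
            (fderiv ℝ (v z.1) z.2 (EuclideanSpace.single 0 1) 2 ≠ 0 ∨ fderiv ℝ (v z.1) z.2 (EuclideanSpace.single 1 1) 2 ≠ 0) ∧
            (fderiv ℝ (v z.1) z.2 (EuclideanSpace.single 2 1) 0 ≠ 0 ∨ fderiv ℝ (v z.1) z.2 (EuclideanSpace.single 2 1) 1 ≠ 0))) ∧
          (∀ m : ℝ → ℝ, ∀ W₁ : Set (ℝ × EuclideanSpace ℝ (Fin 3)), W₁ ⊆ W → IsOpen W₁ → W₁.Nonempty →
            ∃ z ∈ W₁, ∃ b : Fin 3, b ≠ 2 ∧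
              fderiv ℝ (v z.1) z.2 (EuclideanSpace.single 2 1) b ≠
                m z.1 * fderiv ℝ (v z.1) z.2 (EuclideanSpace.single b 1) 2) ∧
          (∀ z ∈ W, (fderiv ℝ (fun x => fderiv ℝ (v z.1) x (EuclideanSpace.single 2 1) 2) z.2 (EuclideanSpace.single 0 1) *
                fderiv ℝ (v z.1) z.2 (EuclideanSpace.single 1 1) 2 -
              fderiv ℝ (fun x => fderiv ℝ (v z.1) x (EuclideanSpace.single 2 1) 2) z.2 (EuclideanSpace.single 1 1) *
                fderiv ℝ (v z.1) z.2 (EuclideanSpace.single 0 1) 2 ≠ 0)) ∧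
          (∃ m : ℝ → ℝ → ℝ, ∀ z ∈ W, ∀ b : Fin 3, b ≠ 2 →
            fderiv ℝ (v z.1) z.2 (EuclideanSpace.single 2 1) b =
              m z.1 (z.2 2) * fderiv ℝ (v z.1) z.2 (EuclideanSpace.single b 1) 2)) ∨
        (∃ W : Set (ℝ × EuclideanSpace ℝ (Fin 3)), IsOpen W ∧ W.Nonempty ∧ W ⊆ Set.Iio (0 : ℝ) ×ˢ Set.univ ∧
          (∃ m : ℝ → ℝ, ∀ z ∈ W, ∀ b : Fin 3, b ≠ 2 →
            fderiv ℝ (v z.1) z.2 (EuclideanSpace.single 2 1) b =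
              m z.1 * fderiv ℝ (v z.1) z.2 (EuclideanSpace.single b 1) 2)) ∨
        (∃ s : ℝ, s < 0 ∧ ∃ U : Set (EuclideanSpace ℝ (Fin 3)), IsOpen U ∧ U.Nonempty ∧
          ((∀ y ∈ U, Literature.Analysis.FluidPDE.curl (v s) y = 0) ∨
           (∀ y ∈ U, fderiv ℝ (v s) y (EuclideanSpace.single 0 1) 2 = 0 ∧ fderiv ℝ (v s) y (EuclideanSpace.single 1 1) 2 = 0) ∨
           (∀ y ∈ U, fderiv ℝ (v s) y (EuclideanSpace.single 2 1) 0 = 0 ∧ fderiv ℝ (v s) y (EuclideanSpace.single 2 1) 1 = 0))) := by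
  sorry

/-- **STUB S3 (RESEARCH, deciding): THE THREADED THICK COLUMN IS EMPTY.**  No profile of the route's Type-I class (rate, continuity,
Oseen-mild identity (M), divergence-free), poloidal along `e₃`, NORMALISED AT THE HOT SPOT (`√(−t)|v₂(t,x)| ≤ |v₂(−1,0)| ≠ 0` on the slab) and
THREADED there (`∇v₂(−1,0) = 0` — supplied free by the proved `threadPin_of_hotSpot`, kept explicit so provers see the pin), carries non-degenerate
twisting THICK windows accumulating at `(−1,0)`.
Handles (card): the pinched-leaf Taylor hierarchy at the thread (structure functions at half rate), the closed-leaf disc moments with the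
twist slack `J·T ≥ 𝒜_z²`, and every free pin of the hot spot (`∂_zv₂ = 0`, `v₂D²v₂ ≤ 0`, `∂ₜv₂ = v₂/2`, signed `∂_zp`).  (M) is load-bearing
(refuter1 K-48/K-50: the (M)-free thick kinematics is inhabited); the statement is about the THICK stratum only — every other stratum
reaching the hot spot is closed by the tree or by the shared (TH) stub (`poloidalLiouville_of_farThread`). -/
theorem stub_threadedThickEmpty :
    ∀ (C : ℝ) (v : ℝ → EuclideanSpace ℝ (Fin 3) → EuclideanSpace ℝ (Fin 3)),
      Literature.Analysis.FluidPDE.HasTypeITimeDecay C v →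
      ContinuousOn (Function.uncurry v) (Set.Iio (0 : ℝ) ×ˢ Set.univ) →
      (∀ s t : ℝ, s < t → t < 0 → ∀ x, v t x =
        Literature.Analysis.UnboundedOperators.heatExtension (v s) (t - s) x -
          Literature.Analysis.FluidPDE.oseenDuhamel 1 s v v t x) →
      (∀ t < 0, Literature.Analysis.FluidPDE.VectorCalculus.IsDivFree (v t)) →
      (∀ s < 0, ∀ y, ⟪Literature.Analysis.FluidPDE.curl (v s) y, EuclideanSpace.single 2 1⟫_ℝ = 0) →
      v (-1) 0 2 ≠ 0 → (∀ t < 0, ∀ x, Real.sqrt (-t) * |v t x 2| ≤ |v (-1) 0 2|) →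
      (∀ h : EuclideanSpace ℝ (Fin 3), fderiv ℝ (v (-1)) 0 h 2 = 0) →
      (deriv (fun s => v s 0 2) (-1) = v (-1) 0 2 / 2 ∧ v (-1) 0 2 * (Δ (fun y => v (-1) y 2)) 0 ≤ 0) →
      ∀ W : Set (ℝ × EuclideanSpace ℝ (Fin 3)), IsOpen W → W ⊆ Set.Iio (0 : ℝ) ×ˢ Set.univ →
        (∀ z ∈ W, (Literature.Analysis.FluidPDE.curl (v z.1) z.2 ≠ 0 ∧
            (fderiv ℝ (v z.1) z.2 (EuclideanSpace.single 0 1) 2 ≠ 0 ∨ fderiv ℝ (v z.1) z.2 (EuclideanSpace.single 1 1) 2 ≠ 0) ∧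
            (fderiv ℝ (v z.1) z.2 (EuclideanSpace.single 2 1) 0 ≠ 0 ∨ fderiv ℝ (v z.1) z.2 (EuclideanSpace.single 2 1) 1 ≠ 0)) ∧
          (fderiv ℝ (fun x => fderiv ℝ (v z.1) x (EuclideanSpace.single 2 1) 2) z.2 (EuclideanSpace.single 0 1) *
                fderiv ℝ (v z.1) z.2 (EuclideanSpace.single 1 1) 2 -
              fderiv ℝ (fun x => fderiv ℝ (v z.1) x (EuclideanSpace.single 2 1) 2) z.2 (EuclideanSpace.single 1 1) *
                fderiv ℝ (v z.1) z.2 (EuclideanSpace.single 0 1) 2 ≠ 0)) →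
        (∀ m : ℝ → ℝ → ℝ, ∀ W₁ : Set (ℝ × EuclideanSpace ℝ (Fin 3)), W₁ ⊆ W → IsOpen W₁ → W₁.Nonempty →
            ∃ z ∈ W₁, ∃ b : Fin 3, b ≠ 2 ∧
              fderiv ℝ (v z.1) z.2 (EuclideanSpace.single 2 1) b ≠
                m z.1 (z.2 2) * fderiv ℝ (v z.1) z.2 (EuclideanSpace.single b 1) 2) →
        (∀ r : ℝ, 0 < r → (Metric.ball ((-1 : ℝ), (0 : EuclideanSpace ℝ (Fin 3))) r ∩ W).Nonempty) →
        False := by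
  sorry

/-- **S5a (time pin; v3: PROVED, formerly half of `stub_threadSignedPin`).**
At the hot spot `(−1, 0)` of `√(−t)|v_z|` over the whole past, the time derivative of `v_z` is PINNED:
`∂ₜ v_z(−1,0) = v_z(−1,0)/2` — Fermat in `t` for `s ↦ √(−s)·σ·v_z(s,0)` (`σ = sign v_z(−1,0)`), time-differentiability
from the joint analyticity of the class (`analyticOnNhd_uncurry`). -/
theorem threadTimePin {v : ℝ → EuclideanSpace ℝ (Fin 3) → EuclideanSpace ℝ (Fin 3)} {C : ℝ}
    (hrate : HasTypeITimeDecay C v)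
    (hcont : ContinuousOn (uncurry v) (Iio (0 : ℝ) ×ˢ univ))
    (hmild : ∀ s t : ℝ, s < t → t < 0 → ∀ x, v t x = UnboundedOperators.heatExtension (v s) (t - s) x - oseenDuhamel 1 s v v t x)
    (hne : v (-1) 0 2 ≠ 0) (hhot : ∀ t < 0, ∀ x, Real.sqrt (-t) * |v t x 2| ≤ |v (-1) 0 2|) :
    deriv (fun s => v s 0 2) (-1) = v (-1) 0 2 / 2 := by
  -- time-differentiability of `s ↦ v_z(s,0)` at `s = −1`
  have han := analyticOnNhd_uncurry hcont (bdd_of_hasTypeITimeDecay hrate) hmild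
  have hmem : ((-1 : ℝ), (0 : EuclideanSpace ℝ (Fin 3))) ∈ Iio (0 : ℝ) ×ˢ (univ : Set (EuclideanSpace ℝ (Fin 3))) :=
    mem_prod.2 ⟨by norm_num, mem_univ _⟩
  have hA : AnalyticAt ℝ (uncurry v) ((-1 : ℝ), (0 : EuclideanSpace ℝ (Fin 3))) := han _ hmem
  have h1 : DifferentiableAt ℝ (fun s : ℝ => (s, (0 : EuclideanSpace ℝ (Fin 3)))) (-1) :=
    differentiableAt_id.prodMk (differentiableAt_const _)
  have h2 : DifferentiableAt ℝ (uncurry v ∘ fun s : ℝ => (s, (0 : EuclideanSpace ℝ (Fin 3)))) (-1) :=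
    hA.differentiableAt.comp (-1) h1
  have hfd : DifferentiableAt ℝ (fun s => v s 0 2) (-1) :=
    ((EuclideanSpace.proj (𝕜 := ℝ) (2 : Fin 3)).differentiableAt).comp (-1) h2
  -- the sign `σ` of `v_z(−1,0)`
  obtain ⟨σ, hσabs, hσa⟩ : ∃ σ : ℝ, |σ| = 1 ∧ σ * v (-1) 0 2 = |v (-1) 0 2| := by
    rcases lt_or_gt_of_ne hne with h | h
    · exact ⟨-1, by simp, by rw [abs_of_neg h]; ring⟩
    · exact ⟨1, by simp, by rw [abs_of_pos h]; ring⟩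
  have hσle : ∀ y : ℝ, σ * y ≤ |y| := fun y =>
    calc σ * y ≤ |σ * y| := le_abs_self _
      _ = |y| := by rw [abs_mul, hσabs, one_mul]
  have hσne : σ ≠ 0 := fun h0 => by rw [h0, abs_zero] at hσabs; exact zero_ne_one hσabs
  -- `g(s) = √(−s)·σ·v_z(s,0)` has a local maximum at `s = −1`
  have hgmax : IsLocalMax (fun s : ℝ => Real.sqrt (-s) * (σ * v s 0 2)) (-1) := by
    have hnhds : ∀ᶠ s in 𝓝 (-1 : ℝ), s < 0 := Iio_mem_nhds (by norm_num)
    filter_upwards [hnhds] with s hs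
    have hR : Real.sqrt (-(-1 : ℝ)) = 1 := by norm_num
    rw [hR, one_mul]
    calc Real.sqrt (-s) * (σ * v s 0 2) ≤ Real.sqrt (-s) * |v s 0 2| :=
          mul_le_mul_of_nonneg_left (hσle _) (Real.sqrt_nonneg _)
      _ ≤ |v (-1) 0 2| := hhot s hs 0
      _ = σ * v (-1) 0 2 := hσa.symm
  have hderiv0 := hgmax.deriv_eq_zero
  -- product rule at `s = −1`
  have hsqrt : HasDerivAt (fun s : ℝ => Real.sqrt (-s)) (1 / (2 * Real.sqrt (-(-1 : ℝ))) * (-1)) (-1) := by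
    have hneg : HasDerivAt (fun s : ℝ => -s) (-1) (-1) := hasDerivAt_neg (-1 : ℝ)
    have hs : HasDerivAt Real.sqrt (1 / (2 * Real.sqrt (-(-1 : ℝ)))) (-(-1 : ℝ)) :=
      Real.hasDerivAt_sqrt (by norm_num)
    exact hs.comp (-1) hneg
  have hg' := hsqrt.mul (hfd.hasDerivAt.const_mul σ)
  have hzero := hg'.deriv.symm.trans hderiv0
  have hR : Real.sqrt (-(-1 : ℝ)) = 1 := by norm_num
  rw [hR] at hzero
  have hkey : σ * (deriv (fun s => v s 0 2) (-1) - v (-1) 0 2 / 2) = 0 := by linear_combination hzero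
  rcases mul_eq_zero.1 hkey with h0 | h0
  · exact absurd h0 hσne
  · linarith

/-- 1-D necessity half of the second-derivative test: a `C²` function with a local maximum at `0` has `φ″(0) ≤ 0`. -/
theorem deriv2_nonpos_of_isLocalMax {φ : ℝ → ℝ} (hφ : ContDiff ℝ 2 φ) (hmax : IsLocalMax φ 0) :
    deriv (deriv φ) 0 ≤ 0 := by
  by_contra hpos
  push Not at hpos
  have hd1 : deriv φ 0 = 0 := hmax.deriv_eq_zero
  have hsign := eventually_nhdsWithin_sign_eq_of_deriv_pos hpos hd1
  obtain ⟨ε, hε, hball⟩ := Metric.eventually_nhds_iff.1 (hsign.and hmax)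
  have hdiff : Differentiable ℝ φ := hφ.differentiable (by norm_num)
  have hpos' : ∀ x : ℝ, 0 < x → x < ε → 0 < deriv φ x := by
    intro x hx0 hxε
    have hx : dist x 0 < ε := by rw [Real.dist_eq, sub_zero, abs_of_pos hx0]; exact hxε
    have h := (hball hx).1
    rw [sub_zero, sign_pos hx0, sign_eq_one_iff] at h
    exact h
  obtain ⟨c, hc, hcd⟩ := exists_deriv_eq_slope φ (by linarith : (0 : ℝ) < ε / 2)
    hdiff.continuous.continuousOn (hdiff.differentiableOn)
  have h1 : 0 < deriv φ c := hpos' c hc.1 (by linarith [hc.2])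
  have hε2 : dist (ε / 2) 0 < ε := by rw [Real.dist_eq, sub_zero, abs_of_pos (by linarith)]; linarith
  have h2 : φ (ε / 2) ≤ φ 0 := (hball hε2).2
  rw [hcd, sub_zero] at h1
  have h3 : 0 < φ (ε / 2) - φ 0 := (div_pos_iff_of_pos_right (by linarith)).1 h1
  linarith

/-- The second derivative of a `C²` function along a line is the second Fréchet derivative on the diagonal. -/
theorem deriv2_line_eq_iteratedFDeriv {f : EuclideanSpace ℝ (Fin 3) → ℝ} (hf : ContDiff ℝ 2 f)
    (x w : EuclideanSpace ℝ (Fin 3)) :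
    deriv (deriv (fun t : ℝ => f (x + t • w))) 0 = iteratedFDeriv ℝ 2 f x ![w, w] := by
  have hd : Differentiable ℝ f := hf.differentiable (by norm_num)
  have hd2 : Differentiable ℝ (fderiv ℝ f) :=
    (hf.fderiv_right (m := 1) (by norm_num)).differentiable one_ne_zero
  have hline : ∀ t : ℝ, HasDerivAt (fun t : ℝ => x + t • w) w t := fun t => by
    simpa using ((hasDerivAt_id t).smul_const w).const_add x
  have h1 : ∀ t : ℝ, HasDerivAt (fun t : ℝ => f (x + t • w)) (fderiv ℝ f (x + t • w) w) t := fun t =>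
    (hd (x + t • w)).hasFDerivAt.comp_hasDerivAt t (hline t)
  have h1' : deriv (fun t : ℝ => f (x + t • w)) = fun t => fderiv ℝ f (x + t • w) w :=
    funext fun t => (h1 t).deriv
  rw [h1']
  have hc : HasDerivAt (fun t : ℝ => fderiv ℝ f (x + t • w)) (fderiv ℝ (fderiv ℝ f) (x + (0 : ℝ) • w) w) 0 :=
    (hd2 (x + (0 : ℝ) • w)).hasFDerivAt.comp_hasDerivAt (0 : ℝ) (hline 0)
  have h2 := hc.clm_apply (hasDerivAt_const (0 : ℝ) w)
  rw [h2.deriv, iteratedFDeriv_two_apply]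
  simp

/-- **S5b (space pin; v3: PROVED, formerly the Laplacian half of `stub_threadSignedPin`).**
At the hot spot `(−1,0)`, `v_z(−1,·)` attains `max |v_z(−1,·)|` at `0` (the weight `√(−t)` is `1` at `t = −1`), so
`v_z(−1,0) · Δ v_z(−1,·)(0) ≤ 0` — each pure second derivative of `σ·v_z(−1,·)` along a line through `0` is `≤ 0`
(1-D necessity) and the Laplacian is their sum over an orthonormal basis; `C²` from the slice analyticity of the class. -/
theorem threadSpacePin {v : ℝ → EuclideanSpace ℝ (Fin 3) → EuclideanSpace ℝ (Fin 3)} {C : ℝ}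
    (hrate : HasTypeITimeDecay C v)
    (hcont : ContinuousOn (uncurry v) (Iio (0 : ℝ) ×ˢ univ))
    (hmild : ∀ s t : ℝ, s < t → t < 0 → ∀ x, v t x = UnboundedOperators.heatExtension (v s) (t - s) x - oseenDuhamel 1 s v v t x)
    (hne : v (-1) 0 2 ≠ 0) (hhot : ∀ t < 0, ∀ x, Real.sqrt (-t) * |v t x 2| ≤ |v (-1) 0 2|) :
    v (-1) 0 2 * (Δ (fun y => v (-1) y 2)) 0 ≤ 0 := by
  set f : EuclideanSpace ℝ (Fin 3) → ℝ := fun y => v (-1) y 2 with hf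
  have hfa : ContDiff ℝ 2 f := by
    have hsl := analyticOnNhd_slice hcont (bdd_of_hasTypeITimeDecay hrate) hmild (by norm_num : (-1 : ℝ) < 0)
    have han : AnalyticOnNhd ℝ f univ := fun y _ =>
      ((EuclideanSpace.proj (𝕜 := ℝ) (2 : Fin 3)).analyticAt _).comp (hsl y (mem_univ _))
    exact han.contDiff
  obtain ⟨σ, hσabs, hσa⟩ : ∃ σ : ℝ, |σ| = 1 ∧ σ * v (-1) 0 2 = |v (-1) 0 2| := by
    rcases lt_or_gt_of_ne hne with h | h
    · exact ⟨-1, by simp, by rw [abs_of_neg h]; ring⟩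
    · exact ⟨1, by simp, by rw [abs_of_pos h]; ring⟩
  have hσle : ∀ y : ℝ, σ * y ≤ |y| := fun y =>
    calc σ * y ≤ |σ * y| := le_abs_self _
      _ = |y| := by rw [abs_mul, hσabs, one_mul]
  have hσ2 : σ * σ = 1 := by
    have h := congrArg (fun r : ℝ => r ^ 2) hσabs
    simp only [sq_abs, one_pow] at h
    nlinarith [h]
  -- every pure second derivative of `σ f` through `0` is `≤ 0`
  have hw : ∀ w : EuclideanSpace ℝ (Fin 3), σ * iteratedFDeriv ℝ 2 f 0 ![w, w] ≤ 0 := by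
    intro w
    have hφc : ContDiff ℝ 2 (fun t : ℝ => σ * f (0 + t • w)) :=
      contDiff_const.mul (hfa.comp (contDiff_const.add (contDiff_id.smul contDiff_const)))
    have hmax : IsLocalMax (fun t : ℝ => σ * f (0 + t • w)) 0 := by
      refine Filter.Eventually.of_forall fun t => ?_
      show σ * f (0 + t • w) ≤ σ * f (0 + (0 : ℝ) • w)
      simp only [zero_smul, add_zero, zero_add]
      have hh := hhot (-1) (by norm_num) (t • w)
      have hR : Real.sqrt (-(-1 : ℝ)) = 1 := by norm_num
      rw [hR, one_mul] at hh
      calc σ * f (t • w) ≤ |f (t • w)| := hσle _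
        _ ≤ |v (-1) 0 2| := hh
        _ = σ * f 0 := hσa.symm
    have hA := deriv2_nonpos_of_isLocalMax hφc hmax
    have hB : deriv (deriv (fun t : ℝ => σ * f (0 + t • w))) 0 = σ * iteratedFDeriv ℝ 2 f 0 ![w, w] := by
      rw [← deriv2_line_eq_iteratedFDeriv hfa 0 w]
      have e1 : deriv (fun t : ℝ => σ * f (0 + t • w)) = fun t => σ * deriv (fun t : ℝ => f (0 + t • w)) t :=
        deriv_const_mul_field' σ
      rw [e1, deriv_const_mul_field']
    rw [hB] at hA
    exact hA
  rw [InnerProductSpace.laplacian_eq_iteratedFDeriv_orthonormalBasis f (EuclideanSpace.basisFun (Fin 3) ℝ)]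
  have hS : σ * ∑ i, iteratedFDeriv ℝ 2 f 0
      ![(EuclideanSpace.basisFun (Fin 3) ℝ) i, (EuclideanSpace.basisFun (Fin 3) ℝ) i] ≤ 0 := by
    rw [Finset.mul_sum]
    exact Finset.sum_nonpos fun i _ => hw _
  have haσ : v (-1) 0 2 = |v (-1) 0 2| * σ := by
    calc v (-1) 0 2 = (σ * σ) * v (-1) 0 2 := by rw [hσ2, one_mul]
      _ = (σ * v (-1) 0 2) * σ := by ring
      _ = |v (-1) 0 2| * σ := by rw [hσa]
  rw [haσ, mul_assoc]
  exact mul_nonpos_of_nonneg_of_nonpos (abs_nonneg _) hS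

/-- **S5 — THE SIGNED PINS (v3: PROVED, sorry-free; was `stub_threadSignedPin`, provable M; answers critic price P2 — first typed contact with (M) at the hot spot).**
For a profile of the route's Type-I class normalised at the hot spot (`√(−t)|v₂(t,x)| ≤ |v₂(−1,0)| ≠ 0`): the interior time-maximum of
`t ↦ √(−t) v₂(t,0) sgn v₂(−1,0)` at `t = −1` gives `∂ₜv₂(−1,0) = v₂(−1,0)/2` EXACTLY, and the spatial maximum of `x ↦ v₂(−1,x) sgn v₂(−1,0)` at `0` gives
`v₂(−1,0)·Δv₂(−1,0) ≤ 0`; hence the signed pin `v₂·(∂ₜ − Δ)v₂ (−1,0) ≥ v₂(−1,0)²/2 > 0` (one line of algebra from the two conjuncts), i.e. with (M) read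
pointwise (`∂ₜw + v·∇w − Δw = −∂_z p`, transport killed by the PROVED thread pin) `v₂·∂_z p(−1,0) ≤ −v₂²/2 < 0`.  PROOF (v3): joint real-analyticity of the class on the open slab (`analyticOnNhd_uncurry` / `analyticOnNhd_slice`) ⇒ `deriv`/`Δ` classical; Fermat in `t`
for `s ↦ √(−s)σv₂(s,0)` (`threadTimePin`); 1-D necessity `φ″(0) ≤ 0` at a local max (`deriv2_nonpos_of_isLocalMax`) along every line through `0`, second line-derivative =
`iteratedFDeriv ℝ 2` on the diagonal (`deriv2_line_eq_iteratedFDeriv`), `Δ = Σᵢ D²f[eᵢ,eᵢ]` over an orthonormal basis (`threadSpacePin`).  No poloidality needed. -/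
theorem threadSignedPin :
    ∀ (C : ℝ) (v : ℝ → EuclideanSpace ℝ (Fin 3) → EuclideanSpace ℝ (Fin 3)),
      Literature.Analysis.FluidPDE.HasTypeITimeDecay C v →
      ContinuousOn (Function.uncurry v) (Set.Iio (0 : ℝ) ×ˢ Set.univ) →
      (∀ s t : ℝ, s < t → t < 0 → ∀ x, v t x =
        Literature.Analysis.UnboundedOperators.heatExtension (v s) (t - s) x -
          Literature.Analysis.FluidPDE.oseenDuhamel 1 s v v t x) →
      (∀ t < 0, Literature.Analysis.FluidPDE.VectorCalculus.IsDivFree (v t)) →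
      v (-1) 0 2 ≠ 0 → (∀ t < 0, ∀ x, Real.sqrt (-t) * |v t x 2| ≤ |v (-1) 0 2|) →
      (deriv (fun s => v s 0 2) (-1) = v (-1) 0 2 / 2 ∧ v (-1) 0 2 * (Δ (fun y => v (-1) y 2)) 0 ≤ 0) :=
  fun C v hrate hcont hmild _ hne hhot =>
    ⟨threadTimePin hrate hcont hmild hne hhot, threadSpacePin hrate hcont hmild hne hhot⟩

/-! ## Proved: the hot spot is a thread -/

/-- Component of a derivative = derivative of the component. -/
theorem fderiv_apply_coord (u : EuclideanSpace ℝ (Fin 3) → EuclideanSpace ℝ (Fin 3)) {x : EuclideanSpace ℝ (Fin 3)}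
    (hu : DifferentiableAt ℝ u x) (h : EuclideanSpace ℝ (Fin 3)) (i : Fin 3) :
    fderiv ℝ (fun z => u z i) x h = fderiv ℝ u x h i := by
  have hc := ((EuclideanSpace.proj (𝕜 := ℝ) i).hasFDerivAt.comp x hu.hasFDerivAt).fderiv
  have hfun : (fun z => u z i) = (EuclideanSpace.proj (𝕜 := ℝ) i) ∘ u := rfl
  rw [hfun, hc]
  rfl

/-- **THE HOT SPOT IS A THREAD (proved).**  Under the normalisation of `stub_extremalThread` the slice `v(−1)` has `∇v₂(0) = 0`:
`|v₂(−1,·)|` attains a global maximum at `0`, and the slice is differentiable (real-analytic, tree `analyticOnNhd_slice`). -/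
theorem threadPin_of_hotSpot {C : ℝ} {v : ℝ → EuclideanSpace ℝ (Fin 3) → EuclideanSpace ℝ (Fin 3)}
    (hrate : Literature.Analysis.FluidPDE.HasTypeITimeDecay C v)
    (hcont : ContinuousOn (Function.uncurry v) (Set.Iio (0 : ℝ) ×ˢ Set.univ))
    (hmild : ∀ s t : ℝ, s < t → t < 0 → ∀ x, v t x =
      Literature.Analysis.UnboundedOperators.heatExtension (v s) (t - s) x -
        Literature.Analysis.FluidPDE.oseenDuhamel 1 s v v t x)
    (hhot : ∀ t < 0, ∀ x, Real.sqrt (-t) * |v t x 2| ≤ |v (-1) 0 2|) :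
    ∀ h : EuclideanSpace ℝ (Fin 3), fderiv ℝ (v (-1)) 0 h 2 = 0 := by
  have hs : (-1 : ℝ) < 0 := by norm_num
  have hA : AnalyticOnNhd ℝ (v (-1)) Set.univ := analyticOnNhd_slice hcont (bdd_of_hasTypeITimeDecay hrate) hmild hs
  have hd : DifferentiableAt ℝ (v (-1)) 0 := (hA 0 (Set.mem_univ _)).differentiableAt
  set f : EuclideanSpace ℝ (Fin 3) → ℝ := fun x => v (-1) x 2 with hf
  have hfd : DifferentiableAt ℝ f 0 := by
    have := ((EuclideanSpace.proj (𝕜 := ℝ) (2 : Fin 3)).hasFDerivAt.comp (0 : EuclideanSpace ℝ (Fin 3)) hd.hasFDerivAt)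
    exact this.differentiableAt
  have hbound : ∀ x, |f x| ≤ |f 0| := by
    intro x
    have h1 := hhot (-1) hs x
    simpa using h1
  -- `fderiv f 0 = 0`: global max of `f` (if `f 0 ≥ 0`) or global min (if `f 0 ≤ 0`)
  have hcrit : fderiv ℝ f 0 = 0 := by
    rcases le_total 0 (f 0) with h0 | h0
    · have hmax : IsLocalMax f 0 := by
        refine Filter.Eventually.of_forall fun x => ?_
        have := hbound x
        rw [abs_of_nonneg h0] at this
        exact (le_abs_self (f x)).trans this
      exact hmax.fderiv_eq_zero
    · have hmin : IsLocalMin f 0 := by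
        refine Filter.Eventually.of_forall fun x => ?_
        have := hbound x
        rw [abs_of_nonpos h0] at this
        have := (neg_le_abs (f x)).trans this
        linarith
      exact hmin.fderiv_eq_zero
  intro h
  have := fderiv_apply_coord (v (-1)) hd h 2
  rw [← this]
  simp [hf.symm ▸ hcrit]

/-! ## Composition, step 1 (proved): the (TH) column in LIOUVILLE currency from the shared local stub (= `twist_split` v4.3's chain) -/

/-- v4.1's local statement from the v4.3 stub (rotation/scaling gauge, Galilean frame and non-umbilic relocation are free:
`…NormalFormRS.localTHEmptyHypNF_of_normalFormRS`, `…Galilean.localTHEmptyHypNonUmbilic_of_galilean`,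
`…NonUmbilic.localTHEmptyHyp_of_localTHEmptyHypNonUmbilic`). -/
theorem localTHEmptyHyp_of_stubNUGRS :
    ∀ (u : ℝ → EuclideanSpace ℝ (Fin 3) → EuclideanSpace ℝ (Fin 3)) (μ A : ℝ → ℝ → ℝ)
      (U : Set (ℝ × EuclideanSpace ℝ (Fin 3))) (p₀ : ℝ × EuclideanSpace ℝ (Fin 3)),
      IsOpen U → p₀ ∈ U →
      AnalyticOnNhd ℝ (Function.uncurry u) U →
      (∀ p ∈ U, AnalyticAt ℝ (Function.uncurry μ) (p.1, p.2 2)) →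
      (∀ p ∈ U, AnalyticAt ℝ (Function.uncurry A) (p.1, p.2 2)) →
      (∀ p ∈ U, fderiv ℝ (u p.1) p.2 (EuclideanSpace.single 0 1) 1 = fderiv ℝ (u p.1) p.2 (EuclideanSpace.single 1 1) 0) →
      (∀ p ∈ U, fderiv ℝ (u p.1) p.2 (EuclideanSpace.single 0 1) 0 + fderiv ℝ (u p.1) p.2 (EuclideanSpace.single 1 1) 1 +
        fderiv ℝ (u p.1) p.2 (EuclideanSpace.single 2 1) 2 = 0) →
      (∀ p ∈ U, ∀ b : Fin 3, b ≠ 2 →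
        fderiv ℝ (u p.1) p.2 (EuclideanSpace.single 2 1) b =
          μ p.1 (p.2 2) * fderiv ℝ (u p.1) p.2 (EuclideanSpace.single b 1) 2) →
      (∀ p ∈ U,
        (1 - μ p.1 (p.2 2)) *
            (deriv (fun s => u s p.2 2) p.1 + fderiv ℝ (fun y => u p.1 y 2) p.2 (u p.1 p.2)
              - Δ (fun y => u p.1 y 2) p.2) =
          A p.1 (p.2 2) + (deriv (fun s => μ s (p.2 2)) p.1 - deriv (deriv (μ p.1)) (p.2 2)) * u p.1 p.2 2
            + deriv (μ p.1) (p.2 2) / 2 * u p.1 p.2 2 ^ 2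
            - 2 * deriv (μ p.1) (p.2 2) * fderiv ℝ (u p.1) p.2 (EuclideanSpace.single 2 1) 2) →
      fderiv ℝ (fun y => fderiv ℝ (u p₀.1) y (EuclideanSpace.single 2 1) 2) p₀.2 (EuclideanSpace.single 0 1) *
            fderiv ℝ (u p₀.1) p₀.2 (EuclideanSpace.single 1 1) 2 -
          fderiv ℝ (fun y => fderiv ℝ (u p₀.1) y (EuclideanSpace.single 2 1) 2) p₀.2 (EuclideanSpace.single 1 1) *
            fderiv ℝ (u p₀.1) p₀.2 (EuclideanSpace.single 0 1) 2 ≠ 0 →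
      μ p₀.1 (p₀.2 2) ≠ 0 → μ p₀.1 (p₀.2 2) ≠ 1 → deriv (μ p₀.1) (p₀.2 2) ≠ 0 →
      μ p₀.1 (p₀.2 2) < 0 → False :=
  localTHEmptyHyp_of_localTHEmptyHypNonUmbilic (localTHEmptyHypNonUmbilic_of_galilean
    (localTHEmptyHypNF_of_normalFormRS stub_localTHEmptyHypNUGRS))

/-- **(TH)∩TWISTING ⇒ the germ trichotomy** — tree `…TwistingTHLocalHypGerm.stub_twistingTH_of_localEmptyHyp` fed with the local stub
(= `twist_split`'s `stub_twistingTH`, same term). -/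
theorem twistingTH_germ :
    ∀ (C : ℝ) (v : ℝ → EuclideanSpace ℝ (Fin 3) → EuclideanSpace ℝ (Fin 3)),
      Literature.Analysis.FluidPDE.HasTypeITimeDecay C v →
      ContinuousOn (Function.uncurry v) (Set.Iio (0 : ℝ) ×ˢ Set.univ) →
      (∀ s t : ℝ, s < t → t < 0 → ∀ x, v t x =
        Literature.Analysis.UnboundedOperators.heatExtension (v s) (t - s) x -
          Literature.Analysis.FluidPDE.oseenDuhamel 1 s v v t x) →
      (∀ t < 0, Literature.Analysis.FluidPDE.VectorCalculus.IsDivFree (v t)) →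
      (∀ s < 0, ∀ y, ⟪Literature.Analysis.FluidPDE.curl (v s) y, EuclideanSpace.single 2 1⟫_ℝ = 0) →
      ∀ W : Set (ℝ × EuclideanSpace ℝ (Fin 3)), IsOpen W → W.Nonempty → W ⊆ Set.Iio (0 : ℝ) ×ˢ Set.univ →
        (∀ z ∈ W, (Literature.Analysis.FluidPDE.curl (v z.1) z.2 ≠ 0 ∧
            (fderiv ℝ (v z.1) z.2 (EuclideanSpace.single 0 1) 2 ≠ 0 ∨ fderiv ℝ (v z.1) z.2 (EuclideanSpace.single 1 1) 2 ≠ 0) ∧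
            (fderiv ℝ (v z.1) z.2 (EuclideanSpace.single 2 1) 0 ≠ 0 ∨ fderiv ℝ (v z.1) z.2 (EuclideanSpace.single 2 1) 1 ≠ 0))) →
        (∀ m : ℝ → ℝ, ∀ W₁ : Set (ℝ × EuclideanSpace ℝ (Fin 3)), W₁ ⊆ W → IsOpen W₁ → W₁.Nonempty →
            ∃ z ∈ W₁, ∃ b : Fin 3, b ≠ 2 ∧
              fderiv ℝ (v z.1) z.2 (EuclideanSpace.single 2 1) b ≠
                m z.1 * fderiv ℝ (v z.1) z.2 (EuclideanSpace.single b 1) 2) →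
        (∀ z ∈ W, (fderiv ℝ (fun x => fderiv ℝ (v z.1) x (EuclideanSpace.single 2 1) 2) z.2 (EuclideanSpace.single 0 1) *
                fderiv ℝ (v z.1) z.2 (EuclideanSpace.single 1 1) 2 -
              fderiv ℝ (fun x => fderiv ℝ (v z.1) x (EuclideanSpace.single 2 1) 2) z.2 (EuclideanSpace.single 1 1) *
                fderiv ℝ (v z.1) z.2 (EuclideanSpace.single 0 1) 2 ≠ 0)) →
        (∃ m : ℝ → ℝ → ℝ, ∀ z ∈ W, ∀ b : Fin 3, b ≠ 2 →
            fderiv ℝ (v z.1) z.2 (EuclideanSpace.single 2 1) b =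
              m z.1 (z.2 2) * fderiv ℝ (v z.1) z.2 (EuclideanSpace.single b 1) 2) →
        ∃ s : ℝ, s < 0 ∧ ∃ U : Set (EuclideanSpace ℝ (Fin 3)), IsOpen U ∧ U.Nonempty ∧
          ((∃ e : EuclideanSpace ℝ (Fin 3), e ≠ 0 ∧
              ∀ y ∈ U, fderiv ℝ (Literature.Analysis.FluidPDE.curl (v s)) y e = 0) ∨
           (∃ c : EuclideanSpace ℝ (Fin 3), ∀ y ∈ U,
              Literature.Analysis.FluidPDE.rotGen (Literature.Analysis.FluidPDE.curl (v s) y) =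
                fderiv ℝ (Literature.Analysis.FluidPDE.curl (v s)) y (Literature.Analysis.FluidPDE.rotGen (y - c))) ∨
           (∃ w : EuclideanSpace ℝ (Fin 3) → EuclideanSpace ℝ (Fin 3), AnalyticOnNhd ℝ w Set.univ ∧
              ¬ BddAbove (Set.range fun y => ‖w y‖) ∧ ∀ y ∈ U, v s y = w y)) :=
  stub_twistingTH_of_localEmptyHyp localTHEmptyHyp_of_stubNUGRS

/-! ## Composition, step 2 (proved): the (TV) column in LIOUVILLE currency (tree) -/

/-- **Time-only slope on SOME window ⇒ `v ≡ 0`** — `…TimeShearPressure.timeShear_normalForm` + the slope dichotomy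
`…TimeShearLiminf.eq_zero_of_timeShear_liminf` / `…HorizontalFlatPast.eq_zero_of_timeShear_unbounded` (the `eq_zero` halves of
`…TimeShearClosed.nonflatLiouville_of_local_timeShear`). -/
theorem eq_zero_of_local_timeOnlySlope {C : ℝ} {v : ℝ → EuclideanSpace ℝ (Fin 3) → EuclideanSpace ℝ (Fin 3)}
    (hrate : Literature.Analysis.FluidPDE.HasTypeITimeDecay C v)
    (hcont : ContinuousOn (Function.uncurry v) (Set.Iio (0 : ℝ) ×ˢ Set.univ))
    (hmild : ∀ s t : ℝ, s < t → t < 0 → ∀ x, v t x =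
      Literature.Analysis.UnboundedOperators.heatExtension (v s) (t - s) x -
        Literature.Analysis.FluidPDE.oseenDuhamel 1 s v v t x)
    (hdiv : ∀ t < 0, Literature.Analysis.FluidPDE.VectorCalculus.IsDivFree (v t))
    (hpol : ∀ s < 0, ∀ y, ⟪Literature.Analysis.FluidPDE.curl (v s) y, EuclideanSpace.single 2 1⟫_ℝ = 0)
    {W : Set (ℝ × EuclideanSpace ℝ (Fin 3))} (hW : IsOpen W) (hWne : W.Nonempty) (hWs : W ⊆ Set.Iio (0 : ℝ) ×ˢ Set.univ)
    {m : ℝ → ℝ}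
    (h : ∀ z ∈ W, ∀ b : Fin 3, b ≠ 2 →
      fderiv ℝ (v z.1) z.2 (EuclideanSpace.single 2 1) b = m z.1 * fderiv ℝ (v z.1) z.2 (EuclideanSpace.single b 1) 2) :
    ∀ t < 0, ∀ x, v t x = 0 := by
  rcases timeShear_normalForm hrate hcont hmild hdiv hpol hW hWne hWs h with hzero | ⟨μ, hμneg, hμa, hslope⟩
  · exact hzero
  · by_cases hB : ∃ M : ℝ, ∀ T : ℝ, ∃ τ < T, -M ≤ μ τ
    · obtain ⟨M, hM⟩ := hB
      exact eq_zero_of_timeShear_liminf hrate hcont hmild hdiv hpol hμneg hslope hμa hM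
    · push Not at hB
      refine eq_zero_of_timeShear_unbounded hrate hcont hmild hdiv hpol hslope fun M => ?_
      obtain ⟨T, hT⟩ := hB M
      refine ⟨T, fun τ hτ => ?_⟩
      have h1 : μ τ < -M := hT τ hτ
      have h2 : M < -μ τ := by linarith
      exact h2.le.trans (neg_le_abs (μ τ))

/-! ## Composition, step 3 (proved): THE POLOIDAL LIOUVILLE THEOREM from the stubs -/

/-- **CLASS + POLOIDAL ⇒ `v ≡ 0`** (modulo `stub_extremalThread`, `stub_threadDichotomy`, `stub_threadedThickEmpty`, `stub_localTHEmptyHypNUGRS`).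
If `v₂ ≡ 0` the profile is horizontally flat (tree); otherwise recentre at the hot spot (S1), sort the hot spot (S2): the threaded thick case
is S3, the untwisted / (TH) cases give a vorticity germ hence `v' ≡ 0` (tree + shared stub), the time-only and degenerate cases give `v' ≡ 0`
(tree) — all contradicting `v'₂(−1,0) ≠ 0`. -/
theorem poloidalLiouville_of_farThread :
    ∀ (C : ℝ) (v : ℝ → EuclideanSpace ℝ (Fin 3) → EuclideanSpace ℝ (Fin 3)),
      Literature.Analysis.FluidPDE.HasTypeITimeDecay C v →
      ContinuousOn (Function.uncurry v) (Set.Iio (0 : ℝ) ×ˢ Set.univ) →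
      (∀ s t : ℝ, s < t → t < 0 → ∀ x, v t x =
        Literature.Analysis.UnboundedOperators.heatExtension (v s) (t - s) x -
          Literature.Analysis.FluidPDE.oseenDuhamel 1 s v v t x) →
      (∀ t < 0, Literature.Analysis.FluidPDE.VectorCalculus.IsDivFree (v t)) →
      (∀ s < 0, ∀ y, ⟪Literature.Analysis.FluidPDE.curl (v s) y, EuclideanSpace.single 2 1⟫_ℝ = 0) →
      ∀ t < 0, ∀ x, v t x = 0 := by
  intro C v hrate hcont hmild hdiv hpol
  by_cases hv2 : ∀ t < 0, ∀ y : EuclideanSpace ℝ (Fin 3), v t y 2 = 0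
  · -- `v₂ ≡ 0`: the slice `−1` is horizontally flat
    have hs : (-1 : ℝ) < 0 := by norm_num
    have hA : AnalyticOnNhd ℝ (v (-1)) Set.univ := analyticOnNhd_slice hcont (bdd_of_hasTypeITimeDecay hrate) hmild hs
    refine eq_zero_of_horizontalGradient_eq_zero_on_open hrate hcont hmild hdiv hs (hpol (-1) hs) isOpen_univ Set.univ_nonempty ?_
    intro y _
    have hd : DifferentiableAt ℝ (v (-1)) y := (hA y (Set.mem_univ _)).differentiableAt
    have hfun : (fun z => v (-1) z 2) = fun _ => (0 : ℝ) := funext fun z => hv2 (-1) hs z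
    have h1 : fderiv ℝ (fun z => v (-1) z 2) y (EuclideanSpace.single 0 1) = 0 := by
      rw [hfun]; simp
    rw [fderiv_apply_coord (v (-1)) hd] at h1
    exact h1
  · push Not at hv2
    obtain ⟨t₀, ht₀, y₀, hy₀⟩ := hv2
    exfalso
    obtain ⟨v', hrate', hcont', hmild', hdiv', hpol', hne, hhot⟩ :=
      stub_extremalThread C v hrate hcont hmild hdiv hpol ⟨t₀, ht₀, y₀, hy₀⟩
    have hs : (-1 : ℝ) < 0 := by norm_num
    -- `v' ≡ 0` is absurd
    have habs : ¬ (∀ t < 0, ∀ x, v' t x = 0) := fun h0 => hne (by rw [h0 (-1) hs 0]; rfl)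
    -- germ ⇒ absurd
    have hgermAbs : ∀ (W : Set (ℝ × EuclideanSpace ℝ (Fin 3))), W.Nonempty → W ⊆ Set.Iio (0 : ℝ) ×ˢ Set.univ →
        (∀ z ∈ W, Literature.Analysis.FluidPDE.curl (v' z.1) z.2 ≠ 0 ∧
            (fderiv ℝ (v' z.1) z.2 (EuclideanSpace.single 0 1) 2 ≠ 0 ∨ fderiv ℝ (v' z.1) z.2 (EuclideanSpace.single 1 1) 2 ≠ 0) ∧
            (fderiv ℝ (v' z.1) z.2 (EuclideanSpace.single 2 1) 0 ≠ 0 ∨ fderiv ℝ (v' z.1) z.2 (EuclideanSpace.single 2 1) 1 ≠ 0)) →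
        (∃ s : ℝ, s < 0 ∧ ∃ U : Set (EuclideanSpace ℝ (Fin 3)), IsOpen U ∧ U.Nonempty ∧
          ((∃ e : EuclideanSpace ℝ (Fin 3), e ≠ 0 ∧
              ∀ y ∈ U, fderiv ℝ (Literature.Analysis.FluidPDE.curl (v' s)) y e = 0) ∨
           (∃ c : EuclideanSpace ℝ (Fin 3), ∀ y ∈ U,
              Literature.Analysis.FluidPDE.rotGen (Literature.Analysis.FluidPDE.curl (v' s) y) =
                fderiv ℝ (Literature.Analysis.FluidPDE.curl (v' s)) y (Literature.Analysis.FluidPDE.rotGen (y - c))) ∨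
           (∃ w : EuclideanSpace ℝ (Fin 3) → EuclideanSpace ℝ (Fin 3), AnalyticOnNhd ℝ w Set.univ ∧
              ¬ BddAbove (Set.range fun y => ‖w y‖) ∧ ∀ y ∈ U, v' s y = w y))) → False := by
      intro W hWne hWs hnd hgerm
      obtain ⟨z₀, hz₀⟩ := hWne
      obtain ⟨s, hs', U, hU, hUne, hg⟩ := hgerm
      exact false_of_germ_of_nondegenerate hrate' hcont' hmild' hdiv' hpol' (Set.mem_prod.1 (hWs hz₀)).1 (hnd z₀ hz₀).1
        hs' hU hUne hg
    have hsp := threadSignedPin C v' hrate' hcont' hmild' hdiv' hne hhot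
    rcases stub_threadDichotomy C v' hrate' hcont' hmild' hdiv' hpol' ((-1 : ℝ), (0 : EuclideanSpace ℝ (Fin 3))) hs with
      ⟨W, hW, hWs, hndtw, hthick, hacc⟩ | ⟨W, hW, hWne, hWs, hnd, htw0⟩ | ⟨W, hW, hWne, hWs, hnd, hpin, htw, hTH⟩ |
      ⟨W, hW, hWne, hWs, m, hm⟩ | ⟨s, hs', U, hU, hUne, hdeg⟩
    · -- (i) threaded thick: THIS LINE's stub
      exact stub_threadedThickEmpty C v' hrate' hcont' hmild' hdiv' hpol' hne hhot
        (threadPin_of_hotSpot hrate' hcont' hmild' hhot) hsp W hW hWs hndtw hthick hacc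
    · -- (ii) untwisted non-degenerate window: tree `stub_untwistedGerm`
      exact hgermAbs W hWne hWs hnd (stub_untwistedGerm C v' hrate' hcont' hmild' hdiv' hpol' W hW hWne hWs hnd htw0)
    · -- (iii) (TH) ∩ twisting: shared stub through the tree chain
      exact hgermAbs W hWne hWs hnd (twistingTH_germ C v' hrate' hcont' hmild' hdiv' hpol' W hW hWne hWs hnd hpin htw hTH)
    · -- (iv) time-only slope: (TV) is empty in Liouville currency
      exact habs (eq_zero_of_local_timeOnlySlope hrate' hcont' hmild' hdiv' hpol' hW hWne hWs hm)
    · -- (v) a degenerate open germ on one slice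
      rcases hdeg with hcurl | hflat | hrig
      · exact habs (eq_zero_of_curl_eq_zero_on_open hrate' hcont' hmild' hdiv' hs' hU hUne hcurl)
      · exact habs (eq_zero_of_horizontalGradient_eq_zero_on_open hrate' hcont' hmild' hdiv' hs' (hpol' s hs') hU hUne
          fun y hy => (hflat y hy).1)
      · exact habs (eq_zero_of_verticalShear_eq_zero_on_open hrate' hcont' hmild' hdiv' hs' hU hUne hrig)

/-! ## Composition, step 4 (proved): the cruxes BY NAME -/

/-- The slice-sharp residue shape of `…Sharper.poloidalWindowRigidity_of_sliceSharpNonflatLiouville` (all genericity hypotheses unused). -/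
theorem sliceSharpNonflatLiouville_of_farThread :
    ∀ (C : ℝ) (v : ℝ → EuclideanSpace ℝ (Fin 3) → EuclideanSpace ℝ (Fin 3)),
      Literature.Analysis.FluidPDE.HasTypeITimeDecay C v →
      ContinuousOn (Function.uncurry v) (Set.Iio (0 : ℝ) ×ˢ Set.univ) →
      (∀ s t : ℝ, s < t → t < 0 → ∀ x, v t x =
        Literature.Analysis.UnboundedOperators.heatExtension (v s) (t - s) x -
          Literature.Analysis.FluidPDE.oseenDuhamel 1 s v v t x) →
      (∀ t < 0, Literature.Analysis.FluidPDE.VectorCalculus.IsDivFree (v t)) →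
      (∀ s < 0, ∀ y, ⟪Literature.Analysis.FluidPDE.curl (v s) y, EuclideanSpace.single 2 1⟫_ℝ = 0) →
      (∀ s < 0, ∀ y, ⟪fderiv ℝ (v s) y (Literature.Analysis.FluidPDE.curl (v s) y), EuclideanSpace.single 2 1⟫_ℝ = 0) →
      (∀ s < 0, ∀ b : EuclideanSpace ℝ (Fin 3), b ≠ 0 → ∃ y,
        Literature.Analysis.FluidPDE.cross (Literature.Analysis.FluidPDE.curl (v s) y) b ≠ 0) →
      (∀ s < 0, ∃ y, fderiv ℝ (v s) y (EuclideanSpace.single 2 1) 0 ≠ 0 ∨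
        fderiv ℝ (v s) y (EuclideanSpace.single 2 1) 1 ≠ 0) →
      (∀ s < 0, ∀ a : EuclideanSpace ℝ (Fin 3), a ≠ 0 → ⟪a, EuclideanSpace.single 2 1⟫_ℝ = 0 →
        ∃ y, ⟪fderiv ℝ (v s) y a, EuclideanSpace.single 2 1⟫_ℝ ≠ 0) →
      (∀ s < 0, ∀ e : EuclideanSpace ℝ (Fin 3), e ≠ 0 → ∃ (y : EuclideanSpace ℝ (Fin 3)) (l : ℝ), v s (y + l • e) ≠ v s y) →
      (∀ s < 0, ∀ (L : EuclideanSpace ℝ (Fin 3) ≃ₗᵢ[ℝ] EuclideanSpace ℝ (Fin 3)) (c : EuclideanSpace ℝ (Fin 3)),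
        ¬ Literature.Analysis.FluidPDE.IsAxisymmetric (fun y => L.symm (v s (L y + c)))) →
      (∃ lam : ℝ, 0 < lam ∧ ∃ s < 0, ∃ y, lam • v (lam ^ 2 * s) (lam • y) ≠ v s y) →
        ¬ Literature.Analysis.FluidPDE.IsBackwardSingularPoint v 0 := by
  intro C v hrate hcont hmild hdiv hpol _ _ _ _ _ _ _
  exact not_backwardSingular_of_zero (poloidalLiouville_of_farThread C v hrate hcont hmild hdiv hpol)

/-- **COMPOSITION (proved): the crux `PoloidalWindowRigidity` (stmt-NavierStokesRegularity-19708) BY NAME** from `stub_extremalThread` (S1, provable),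
`stub_threadDichotomy` (S2, provable), `stub_threadedThickEmpty` (S3, deciding) and the shared `stub_localTHEmptyHypNUGRS` ((TH) column,
`twist_split` v4.3), via the landed reduction `…Sharper.poloidalWindowRigidity_of_sliceSharpNonflatLiouville`. -/
theorem PoloidalWindowRigidity_of_farThread :
    Summit.NavierStokesRegularity.NavierStokesRegularity.Theses.PoloidalWindowDoor.PoloidalWindowRigidity :=
  poloidalWindowRigidity_of_sliceSharpNonflatLiouville sliceSharpNonflatLiouville_of_farThread

/-- **COMPOSITION (proved): the promoted stub `LrcModEntire` (stmt-NavierStokesRegularity-20428) BY NAME** — a poloidal class profile is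
`≡ 0`, so a non-degenerate window is absurd. -/
theorem LrcModEntire_of_farThread :
    Summit.NavierStokesRegularity.NavierStokesRegularity.Theses.PoloidalWindowDoor.LrcModEntire := by
  intro C v hrate hcont hmild hdiv hpol W hW hWne hWs hnd hpin
  exfalso
  obtain ⟨z₀, hz₀⟩ := hWne
  have hzero := poloidalLiouville_of_farThread C v hrate hcont hmild hdiv hpol
  apply (hnd z₀ hz₀).1
  have hfun : v z₀.1 = fun _ => 0 := funext fun x => hzero z₀.1 (Set.mem_prod.1 (hWs hz₀)).1 x
  rw [hfun]
  simp [Literature.Analysis.FluidPDE.curl]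

end Summit.NavierStokesRegularity.NavierStokesRegularity.Cruxes.PoloidalWindowRigidity.FarThread
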